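import Literature.Geometry.Lorentzian.SoundNearKerrLeaf
import Literature.Geometry.Lorentzian.NearKerrCollarCore
import Literature.Geometry.Lorentzian.ApproximateKerrConfigurationReanchor
import Summits.FinalStateConjecture.FinalStateConjecture.Theorems.BartnikGapSettlingBondiBartnikRigidityDirectMethodDefs
import Summits.FinalStateConjecture.FinalStateConjecture.Theorems.BartnikGapSettlingBondiBartnikRigidityDirectMethodLeafDefs
import Summits.FinalStateConjecture.FinalStateConjecture.Theorems.BartnikGapSettlingBondiBartnikRigidityStationaryKerrCollarRouteOriented
import HarnessLib

/-!
# Far completion — stub K4 `stub_farCompletion` of the line `direct-method-on-the-cone`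
# (crux `BondiBartnikRigidity`, stmt-FinalStateConjecture-10807): vocabulary and the typed far-field inputs

K4 turns the `(ε₁, k₁)`-Kerr BOX `{τ < t* < τ + T, M < r < R + 1}` inside `J⁺(C)` that K3 delivers
into a SOUND `(ε, k)`-near-Kerr leaf `S' ⊆ J⁺(C)` (`CauchyDevelopment.IsSoundNearKerrLeaf`, one hole).
Mechanism (worker K4 of lead a2, `Cruxes/…/Lines/direct_method_on_the_cone_K4.lean`; this revision by the
wave-3 worker of lead c3): the hole chart of `S'` is the box chart itself, RECENTRED — the late slab
`{t* = s}` becomes `{t*' = 0}` by shifting the Kerr-star time (`shiftTime`; Kerr–Schild stationarity,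
`shiftTime_starBackground`) and the coordinates are translated by `w` (`translateBackground`,
`translateMap`) so that the hole sits near the axis of the flat chart's unit hyperboloid — and is
layer-certified by the box; the flat chart is an `ε`-flat achronal unit-hyperboloidal LAYER through the
overlap annulus out to null infinity (`IsFarChart`, eleven clauses), which is the missing analytic
content.  This file carries the vocabulary and the two route-posited inputs; the sorry-free assembly
(box + far chart ⟹ sound leaf `⊆ J⁺(C)`, all 25 clauses) is `…FarCompletionAssembly.lean`, the
translation covariance of boxes and the reduction
`stub_farCompletion ⟸ FarHyperboloidalCompletionRest ∧ RestCollarBoxOriented` are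
`…FarCompletionReduction.lean`.

* `shiftTime B s`, `translateBackground B w`, `translateMap B w`, `recentre mo s w` — recentring a
  reference background / a Kerr motion in time and space (the identity "recentred star background =
  star background of the recentred motion" is proved in `…FarCompletionReduction.lean`);
* `nearLayer`, `nearUpper`, `nearAnnulus`, `flatLayer`, `flatUpper`, `flatAnnulus` — the layer sets of
  `IsSoundNearKerrLeaf` as definitions (registered bookkeeping sub-goal `stub_discInNearZoneLayer`, the
  anchor of this file: the disc lies in the truncated near-zone layer);
* `IsFarChart` — the far (flat) half of a one-hole sound leaf relative to a hole chart (bookkeeping notion);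
* `BoxTimeOriented` — the box analogue of `K2Route.CollarTimeOriented` (`IsNearModelBox` certifies the
  metric tensor only);
* `FarHyperboloidalCompletionRest` (F2ʳ) — THE INPUT: rest-frame, time-oriented box ⟹ far chart after
  recentring; the conjunction of semi-global Cauchy-characteristic existence/decay near `𝓘⁺` relative to
  KERR (Klainerman–Nicolò prove the Minkowski-relative theorem; the Kerr version is unprinted), a
  Bondi-flux budget from the gap, and high-frequency exclusion from the pinned sound hypothesis leaf;
* `RestCollarBoxOriented` — the bridge supplying the orientation of the registered stub's
  (orientation-blind) box below a quality threshold; discharged for free once the orientation of K3's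
  box is threaded through the skeleton (recommended).

AUDIT of F2ʳ as typed (details in the docstrings): not junk-false by BOOST (rest-frame clause consumed:
without it the coupling of the flat domain to the hole's boosted radius function is already
unsatisfiable kinematically), by TRANSLATION (the engine chooses `w`: the hypotheses are invariant under
translating the collar's coordinates while `hypBackground`'s hyperboloid is anchored at the origin), or
by TIME REVERSAL of the box (oriented box consumed); not junk-true (no cheap far chart: an `ε`-flat
unit-hyperboloidal layer has infinite `4`-volume and the deviation is from `η` itself, so neither the box
nor a rescaled small region supplies it); hypotheses satisfiable on paper (stability of slowly rotating
Kerr + exterior gluing), not in the tree.  All `def … : Prop` here are route-posited statements or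
hypothesis clauses; nothing is asserted.

References: Klainerman–Nicolò, *The evolution problem in general relativity* (2003), Thm. 1.1
[KlainermanNicolo2003]; J. Luk, arXiv:1107.0898 [Luk2012CharIVP]; Dafermos–Holzegel–Rodnianski–Taylor
arXiv:2104.08222, §1 [DafermosHolzegelRodnianskiTaylor2021]; Christodoulou–Klainerman 1993, Ch. 17
[ChristodoulouKlainerman1993PMS41]; Kerr–Schild 1965, §2 [KerrSchild1965]; Dafermos–Rodnianski
arXiv:0811.0354, §5.1 [DafermosRodnianski2008]; O'Neill 1983, Ch. 9, p. 236 [ONeillSemiRiemannian1983].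
-/


noncomputable section

-- D-0017: single-problem summit, `Summit.<S>.<S>.…` by design (cf. lakefile `weak.linter.dupNamespace`).
set_option linter.dupNamespace false
-- instance search through the nested operator types of the Kerr chart facts
set_option maxSynthPendingDepth 3

open Set Filter Function Topology TopologicalSpace
open Literature.Geometry.Lorentzian
open scoped Manifold ContDiff Topology ENNReal

namespace Summit.FinalStateConjecture.FinalStateConjecture.Theorems.BondiBartnikRigidity.DirectMethod

universe u

/-! ### Recentring a reference background in time -/

/-- The background `B` with its time function shifted by `s` (`t ↦ t − s`): the slab `{t = s}` of
`B` becomes the slab `{t' = 0}`; domain, reference form and radius unchanged (definitionally).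
[folklore] -/
abbrev shiftTime (B : ModelBackground) (s : ℝ) : ModelBackground :=
  ⟨B.domain, B.bilin, fun x => B.time x - s, B.radius⟩

/-- The domain of the time-shifted background is that of `B`. [folklore] -/
@[simp] theorem shiftTime_domain (B : ModelBackground) (s : ℝ) : (shiftTime B s).domain = B.domain :=
  rfl

/-- The reference form of the time-shifted background is that of `B`. [folklore] -/
@[simp] theorem shiftTime_bilin (B : ModelBackground) (s : ℝ) : (shiftTime B s).bilin = B.bilin := rfl

/-- The time of the time-shifted background is `t − s`. [folklore] -/
@[simp] theorem shiftTime_time (B : ModelBackground) (s : ℝ) (x : E4) :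
    (shiftTime B s).time x = B.time x - s := rfl

/-- The radius of the time-shifted background is that of `B`. [folklore] -/
@[simp] theorem shiftTime_radius (B : ModelBackground) (s : ℝ) : (shiftTime B s).radius = B.radius :=
  rfl

/-- The metric deviation of a chart is unchanged by shifting the background's time function (it
involves only the domain and the reference form). [folklore] -/
theorem deviationExtend_shiftTime (𝒮 : Spacetime.{u} 4) (B : ModelBackground) (s : ℝ)
    (Ψ : B.domain → 𝒮.carrier) :
    𝒮.deviationExtend (shiftTime B s) Ψ = 𝒮.deviationExtend B Ψ :=
  rfl

/-! ### Translating a reference background and its charts in `E4` -/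

/-- The background `B` presented in coordinates translated by `w` (`y = x − w`): domain
`{y | y + w ∈ B.domain}`, reference form, time and radius precomposed with `y ↦ y + w`.
[folklore] -/
def translateBackground (B : ModelBackground) (w : E4) : ModelBackground :=
  ⟨⟨(fun y : E4 => y + w) ⁻¹' (B.domain : Set E4),
      B.domain.isOpen.preimage (continuous_id.add continuous_const)⟩,
    fun y => B.bilin (y + w), fun y => B.time (y + w), fun y => B.radius (y + w)⟩

/-- Membership in the translated domain. [folklore] -/
@[simp] theorem mem_translateBackground_domain {B : ModelBackground} {w y : E4} :
    y ∈ (translateBackground B w).domain ↔ y + w ∈ B.domain :=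
  Iff.rfl

/-- The reference form of the translated background. [folklore] -/
@[simp] theorem translateBackground_bilin (B : ModelBackground) (w y : E4) :
    (translateBackground B w).bilin y = B.bilin (y + w) := rfl

/-- The time of the translated background. [folklore] -/
@[simp] theorem translateBackground_time (B : ModelBackground) (w y : E4) :
    (translateBackground B w).time y = B.time (y + w) := rfl

/-- The radius of the translated background. [folklore] -/
@[simp] theorem translateBackground_radius (B : ModelBackground) (w y : E4) :
    (translateBackground B w).radius y = B.radius (y + w) := rfl

/-- The translation `y ↦ y + w` from the translated domain onto the domain of `B` (the map along
which charts of `B` are re-presented in the translated coordinates: `Ψ ∘ translateMap B w`).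
[folklore] -/
def translateMap (B : ModelBackground) (w : E4) : (translateBackground B w).domain → B.domain :=
  fun y => ⟨y.1 + w, y.2⟩

/-- Unfolding lemma. [folklore] -/
@[simp] theorem translateMap_coe (B : ModelBackground) (w : E4) (y : (translateBackground B w).domain) :
    ((translateMap B w y : B.domain) : E4) = y.1 + w := rfl

/-- `translateMap` is the library's `ModelBackground.translate` between the translated background and
`B` (so its calculus — smoothness, differential `= id`, homeomorphism — is available). [folklore] -/
theorem translateMap_eq_translate (B : ModelBackground) (w : E4) :
    translateMap B w = (translateBackground B w).translate B w (fun _ h => h) := rfl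

/-! ### Recentring a Kerr motion -/

/-- The motion `(Λ, c)` RECENTRED by the coordinate translation `w` and `s` units of its own
rest-frame time: `(Λ, c − w + Λ (s e₀))`. [folklore] -/
def recentre (mo : lorentzGroup × E4) (s : ℝ) (w : E4) : lorentzGroup × E4 :=
  (mo.1, mo.2 - w + (mo.1 : E4 ≃L[ℝ] E4) (s • E4.basisVector 0))

/-- The Lorentz part of the recentred motion is unchanged. [folklore] -/
@[simp] theorem recentre_fst (mo : lorentzGroup × E4) (s : ℝ) (w : E4) : (recentre mo s w).1 = mo.1 :=
  rfl

/-- The translation part of the recentred motion. [folklore] -/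
theorem recentre_snd (mo : lorentzGroup × E4) (s : ℝ) (w : E4) :
    (recentre mo s w).2 = mo.2 - w + (mo.1 : E4 ≃L[ℝ] E4) (s • E4.basisVector 0) :=
  rfl

/-! ### The near-zone and flat layer sets of a leaf -/

/-- The NEAR-ZONE LAYER `{−1 < t < 1, r < R₁ + 1}` of a background (the set `Lᵢ` of
`IsSoundNearKerrLeaf`). [cite: DafermosHolzegelRodnianskiTaylor2021, §1] -/
def nearLayer (B : ModelBackground) (R₁ : ℝ) : Set B.domain :=
  {x | -1 < B.time x.1 ∧ B.time x.1 < 1 ∧ B.radius x.1 < R₁ + 1}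

/-- The UPPER near-zone layer `{0 < t < 1, r ≤ R₁}` (the set `Wᵢ` of `IsSoundNearKerrLeaf`).
[cite: DafermosHolzegelRodnianskiTaylor2021, §1] -/
def nearUpper (B : ModelBackground) (R₁ : ℝ) : Set B.domain :=
  {x | 0 < B.time x.1 ∧ B.time x.1 < 1 ∧ B.radius x.1 ≤ R₁}

/-- The hole-side OVERLAP ANNULUS `{t = 0, ρ < r ≤ R₁}`. [cite: DafermosHolzegelRodnianskiTaylor2021, §1] -/
def nearAnnulus (B : ModelBackground) (ρ R₁ : ℝ) : Set B.domain :=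
  {x | B.time x.1 = 0 ∧ ρ < B.radius x.1 ∧ B.radius x.1 ≤ R₁}

/-- The flat LAYER `{−1 < t₀ < 1}` of the hyperboloidal background on `U₀` (the set `L₀`).
[cite: DafermosHolzegelRodnianskiTaylor2021, §1] -/
def flatLayer (U₀ : Opens E4) : Set (hypBackground U₀).domain :=
  {x | -1 < (hypBackground U₀).time x.1 ∧ (hypBackground U₀).time x.1 < 1}

/-- The upper flat layer `{0 < t₀ < 1}` (the set `W₀`). [cite: DafermosHolzegelRodnianskiTaylor2021, §1] -/
def flatUpper (U₀ : Opens E4) : Set (hypBackground U₀).domain :=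
  {x | 0 < (hypBackground U₀).time x.1 ∧ (hypBackground U₀).time x.1 < 1}

/-- The flat-side OVERLAP ANNULUS `{t₀ = 0, ρ < r(x) < R₁}` for a radius function `r` on `E4`.
[cite: DafermosHolzegelRodnianskiTaylor2021, §1] -/
def flatAnnulus (U₀ : Opens E4) (r : E4 → ℝ) (ρ R₁ : ℝ) : Set (hypBackground U₀).domain :=
  {x | (hypBackground U₀).time x.1 = 0 ∧ ρ < r x.1 ∧ r x.1 < R₁}

/-! ### Far charts, time-oriented boxes -/

section FarChart

variable {X : Type u} [TopologicalSpace X] [ChartedSpace E3 X] [IsManifold (𝓡 3) ∞ X]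
  [ConnectedSpace X] {D : InitialDataSet (𝓡 3) X}

/-- **FAR CHART relative to a hole chart** — the far (hyperboloidal, flat-background) half of a
sound `(ε, k)`-near-Kerr leaf with ONE hole, as a list of clauses on a flat domain `U₀ ⊆ E4` and a
flat chart `Ψ₀ : U₀ → 𝒟`, relative to a hole chart `Ψ : B'.domain → 𝒟` of the background `B'`
(in applications the recentred star background of the motion `mo'`, spin `a₀`), the overlap radii
`ρ < R₁` and the core `C`: (F1) `U₀ ⊇ {t₀ > −1, r' > ρ}`, `r'` the Kerr–Schild radius of `mo'`;
(F2) `Ψ₀` is smooth on the flat layer `L₀ = {−1 < t₀ < 1}`, an open embedding of it, with image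
in `J⁺(ι X)`; (F3) the `Cᵏ` deviation of `Ψ₀^* g` from `η` over the whole layer is `≤ ε`
(unweighted Cartesian components, clause (S₃) of `IsSoundNearKerrLeaf`); (F4) the overlap clauses:
the hole annulus `{t' = 0, ρ < r ≤ R₁}` is charted by the flat layer and the flat annulus
`{t₀ = 0, ρ < r' < R₁}` by the hole's near-zone layer; (F5) the causal clauses of the leaf
`S' = Ψ₀{t₀ = 0} ∪ Ψ{t' = 0, r ≤ R₁}`: upper layers in `I⁺(S')`, the barrier clause
`exteriorOf W ∖ W ⊆ J⁻(S')`, the flat sheet ACHRONAL (S₅), and the flat sheet inside `J⁺(C)`.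
Chart / deviation vocabulary: DHRT arXiv:2104.08222, §1.  A bookkeeping notion (the conclusion of
the far-field input `FarHyperboloidalCompletionRest`); nothing is asserted about it.
[cite: DafermosHolzegelRodnianskiTaylor2021, §1] -/
def IsFarChart (𝒟 : VacuumCauchyDevelopment D) (k : ℕ) (ε : ℝ≥0∞) (a₀ : ℝ)
    (mo' : lorentzGroup × E4) (B' : ModelBackground) (Ψ : B'.domain → 𝒟.carrier)
    (C : Set 𝒟.carrier) (R₁ ρ : ℝ) (U₀ : Opens E4)
    (Ψ₀ : (hypBackground U₀).domain → 𝒟.carrier) : Prop :=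
  -- (F1) the flat domain contains `{t₀ > −1, r' > ρ}`
  {x : E4 | -1 < x 0 - Real.sqrt (1 + E4.spatialNorm x ^ 2) ∧
      ρ < Kerr.radius a₀ (poincareInv mo'.1 mo'.2 x)} ⊆ (U₀ : Set E4) ∧
  -- (F2) the flat chart on its layer
  ContMDiffOn 𝓘(ℝ, E4) (𝓡 4) ∞ Ψ₀ (flatLayer U₀) ∧
  IsOpenEmbedding ((flatLayer U₀).restrict Ψ₀) ∧
  Ψ₀ '' flatLayer U₀ ⊆ 𝒟.metric.causalFuture 𝒟.timeOrientation (range 𝒟.embed) ∧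
  -- (F3) `ε`-flatness in `Cᵏ` over the whole layer
  supCkENorm (Subtype.val '' flatLayer U₀) k
      (𝒟.toSpacetime.deviationExtend (hypBackground U₀) Ψ₀) ≤ ε ∧
  -- (F4) overlaps with the hole chart
  Ψ '' nearAnnulus B' ρ R₁ ⊆ Ψ₀ '' flatLayer U₀ ∧
  Ψ₀ '' flatAnnulus U₀ (fun x => Kerr.radius a₀ (poincareInv mo'.1 mo'.2 x)) ρ R₁ ⊆
    Ψ '' nearLayer B' R₁ ∧
  -- (F5) causal clauses of the leaf `S' = sheet ∪ disc`
  Ψ₀ '' flatUpper U₀ ∪ Ψ '' nearUpper B' R₁ ⊆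
    𝒟.metric.chronologicalFuture 𝒟.timeOrientation
      (Ψ₀ '' (hypBackground U₀).timeSlab 0 ∪ Ψ '' B'.truncTimeSlab R₁ 0) ∧
  𝒟.toCauchyDevelopment.exteriorOf (Ψ₀ '' flatUpper U₀ ∪ Ψ '' nearUpper B' R₁) \
      (Ψ₀ '' flatUpper U₀ ∪ Ψ '' nearUpper B' R₁) ⊆
    𝒟.metric.causalPast 𝒟.timeOrientation
      (Ψ₀ '' (hypBackground U₀).timeSlab 0 ∪ Ψ '' B'.truncTimeSlab R₁ 0) ∧
  𝒟.metric.IsAchronal 𝒟.timeOrientation (Ψ₀ '' (hypBackground U₀).timeSlab 0) ∧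
  Ψ₀ '' (hypBackground U₀).timeSlab 0 ⊆ 𝒟.metric.causalFuture 𝒟.timeOrientation C

/-- **TIME-ORIENTED BOX**: on the coordinate box `{τ₁ < t < τ₂, r₁ < r < r₂}` the chart `Ψ` pushes
the Kerr-star time orientation `Λ V`, `V = −g♯dt*` (`Kerr.timeVector`, future timelike for the
boosted Kerr form on `{r > M}`), to a FUTURE-directed vector of `𝒱` — the box analogue of
`K2Route.CollarTimeOriented`.  `IsNearModelBox` certifies the metric tensor only, so without this
clause an `(ε₁, k₁)`-box may be a time-REVERSED (white-hole-like) presentation; the far completion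
consumes a future-oriented box.  A hypothesis clause; nothing is asserted. [conjecture] [folklore] -/
def BoxTimeOriented (𝒱 : VacuumCauchyDevelopment D) (M a : ℝ) (mo : lorentzGroup × E4)
    (B : ModelBackground) (τ₁ τ₂ r₁ r₂ : ℝ) (Ψ : B.domain → 𝒱.carrier) : Prop :=
  ∀ x ∈ coordBox B τ₁ τ₂ r₁ r₂, 𝒱.timeOrientation.IsFutureDirected
    (mfderiv 𝓘(ℝ, E4) (𝓡 4) Ψ x
      ((mo.1 : E4 ≃L[ℝ] E4) (Kerr.timeVector M a (poincareInv mo.1 mo.2 x.1))))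

end FarChart

/-! ### The typed far-field inputs of K4 (route-posited; nothing is asserted) -/

/-- **F2ʳ — FAR HYPERBOLOIDAL COMPLETION, REST FRAME** (the far-field engine of the stub K4
`stub_farCompletion` of the line `direct-method-on-the-cone`; shared with `core-cone-calibration` K4 and
the far zone F3/B2 of `hyperboloidal-mass-pinches-flat`).  STATEMENT.  For every margin/window `(χ, m₀)`
and target `(k, ε)` the engine names the box it needs — quality `(k₁, ε₁)` with `ε₁ ≤ ε`, `k ≤ k₁`,
radius `R` (≳ `M/ε`: Kerr is `ε`-flat beyond the overlap annulus) and LENGTH `T` (≳ the light-crossing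
time of the zone it certifies) — and a `k'`; then for `Λ < 1` some `δ, γ > 0` make the following true
for every MGHD `𝒟` of admissible vacuum data, every PINNED SOUND `(Λ, k')`-leaf `S ∋ p`, every
REST-FRAME (`(mo 0).1 = 1`), future-oriented, `δ`-Kerr thick collar through `p` with a cut energy and
Bondi–Bartnik gap `≤ γ` (`NearKerrCollarCore`), and every TIME-ORIENTED `(ε₁, k₁)`-Kerr box
`Ψ : {τ < t* < τ + T, M < r < R + 1} → J⁺(C)` of the collar's background: after recentring the hole
chart by a coordinate translation `w` and a rest-frame time `s` with `[s − 1, s + 1] ⊆ [τ, τ + T]`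
(`Ψ ∘ translateMap`, `shiftTime ∘ translateBackground`; the recentred background is the star background
of `recentre (mo 0) s w`), there is a FAR CHART (`IsFarChart`) with overlap radii `0 < ρ < R₁`,
`2M ≤ R₁ ≤ R`: an `ε`-flat (in `Cᵏ`, unweighted) achronal unit-hyperboloidal layer through the overlap
annulus out to null infinity, mutually charted with the hole's near-zone layer, with the causal clauses
of a leaf and its sheet inside `J⁺(C)`.  WHY NEEDED.  With the proved assembly
(`…FarCompletionAssembly`: box ⟹ near-zone layer of the recentred background; near zone + far chart ⟹
SOUND leaf `⊆ J⁺(C)`, all 25 clauses) and the translation covariance of boxes, it is exactly what turns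
K3's box into K4's sound leaf (`stub_farCompletion_of_facts`).  CONTENT (why it is research-level, size XL).
The conjunction of (a) semi-global Cauchy-characteristic existence and decay near `𝓘⁺` RELATIVE TO KERR
with small characteristic but LARGE interior data — Klainerman–Nicolò prove the Minkowski-relative
exterior theorem (2003, Thm. 1.1), Luk the local characteristic problem (2012); the Kerr-relative
version is NOT in print (barrier `NullConditionFailure`, evasion (i): double-null/Bianchi); (b) a
Bondi-FLUX BUDGET: incoming radiation crossing the cone `∂J⁺(C)` beyond the collar costs cut energy, so
gap `≤ γ` bounds its flux (needs competitor realisation by exterior gluing); (c) HIGH-FREQUENCY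
EXCLUSION: flux-small incoming trains are `Cᵏ`-small only by interpolation against the hypothesis leaf's
`C^{k'}` layer bound (`k' ≈ 3k`, Gagliardo–Nirenberg cell by cell) — this is where the PINNED SOUND
hypothesis leaf and the REST-FRAME clause are consumed: component certification is frame-dependent and
a boosted collar/box interface hides null-aligned content (worker K4 of lead a2: already exact Kerr
presented with rapidity `β`, `e^{2β} > εR/4M`, admits no far chart), while far-tipped unpinned sheets
admit gap-affordable focused trains (worker K3 of lead a2).  AUDIT (this file's worker).  (i) The
translation `w` is necessary for honesty: the hypotheses are invariant under translating the collar's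
coordinates, the unit hyperboloid of `hypBackground` is anchored at the origin of `E4`, and a hole
annulus of radius `R₁ ≳ M/ε` displaced by `L ≫ R₁` from the axis does not fit the flat layer
`{−1 < t₀ < 1}` in any near-inertial flat chart; (ii) the box must be TIME-ORIENTED (`BoxTimeOriented`):
`IsNearModelBox` is orientation-blind and the causal clauses (F5) fail for a reversed box — the intended
producer (K3 ∘ K2′, marching) delivers an oriented box, and `RestCollarBoxOriented` bridges to the
registered K4; (iii) no cheap far chart exists (an `ε`-flat unit-hyperboloidal layer has infinite
`4`-volume and cannot be drawn from the box or by rescaling: the deviation is from `η` itself); (iv) the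
hypotheses are satisfiable on paper (sub-extremal Kerr exterior glued to admissible data, `|a| ≪ M`,
by the stability of Kerr), not in the tree.  Sources: Klainerman–Nicolò 2003, Thm. 1.1; Luk
arXiv:1107.0898; DHRT arXiv:2104.08222, §1; Christodoulou–Klainerman 1993, Ch. 17.
Route-posited statement; nothing is asserted. [conjecture] [cite: KlainermanNicolo2003, Thm. 1.1] -/
def FarHyperboloidalCompletionRest : Prop :=
  ∀ (χ m₀ : ℝ) (k : ℕ) (ε : ℝ≥0∞), χ < 1 → 0 < m₀ → 0 < ε →
    ∃ (k₁ : ℕ) (ε₁ : ℝ≥0∞) (R T : ℝ), 0 < ε₁ ∧ ε₁ ≤ ε ∧ k ≤ k₁ ∧ ∃ k' : ℕ, ∀ Λ : ℝ≥0∞, Λ < 1 →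
    ∃ (δ : ℝ≥0∞) (γ : ℝ), 0 < δ ∧ 0 < γ ∧
    ∀ (X : Type) [TopologicalSpace X] [ChartedSpace E3 X] [IsManifold (𝓡 3) ∞ X]
      [T2Space X] [SecondCountableTopology X] [ConnectedSpace X],
    ∀ D ∈ admissibleVacuumData X, ∀ (𝒟 : VacuumCauchyDevelopment D)
      (M a : Fin 1 → ℝ) (S : Set 𝒟.carrier) (p : 𝒟.carrier) (mo : Fin 1 → lorentzGroup × E4)
      (B : Fin 1 → ModelBackground) (Φ : ∀ i, (B i).domain → 𝒟.carrier),
    𝒟.IsMaximal → (∀ i, m₀ ≤ M i ∧ M i ≤ m₀⁻¹ ∧ |a i| ≤ χ * M i) →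
    IsPinnedSoundNearKerrLeaf 𝒟.toCauchyDevelopment k' Λ 1 M a S → p ∈ S →
    (∃ i, p ∈ Φ i '' (B i).truncTimeSlab (3 * M i) 0) → (mo 0).1 = 1 →
    𝒟.NearKerrCollarCore k' δ γ 1 M a S p mo B Φ →
    K2Route.CollarFutureOriented 𝒟 M mo B Φ → K2Route.CollarTimeOriented 𝒟 M a mo B Φ →
    ∀ (τ : ℝ) (Ψ : (B 0).domain → 𝒟.carrier),
      IsNearModelBox 𝒟.toSpacetime (B 0) k₁ ε₁ τ (τ + T) (M 0) (R + 1)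
        (𝒟.metric.causalFuture 𝒟.timeOrientation (collarCore M p B Φ)) Ψ →
      BoxTimeOriented 𝒟 (M 0) (a 0) (mo 0) (B 0) τ (τ + T) (M 0) (R + 1) Ψ →
    ∃ (w : E4) (s R₁ ρ : ℝ) (U₀ : Opens E4) (Ψ₀ : (hypBackground U₀).domain → 𝒟.carrier),
      τ ≤ s - 1 ∧ s + 1 ≤ τ + T ∧ 0 < ρ ∧ ρ < R₁ ∧ 2 * M 0 ≤ R₁ ∧ R₁ ≤ R ∧
      IsFarChart 𝒟 k ε (a 0) (recentre (mo 0) s w) (shiftTime (translateBackground (B 0) w) s)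
        (Ψ ∘ translateMap (B 0) w) (collarCore M p B Φ) R₁ ρ U₀ Ψ₀

/-- **BOX ORIENTATION BRIDGE** (`RestCollarBoxOriented`) — the interface clause between K3 (which
PRODUCES the box) and F2ʳ (which consumes a TIME-ORIENTED box), in the form needed to serve the
registered, orientation-blind K4: for every margin/window and box regularity `k₁` there is a quality
threshold `ε⋆ > 0` such that, in the setting of K4 (MGHD of admissible data, pinned sound hypothesis
leaf, rest-frame future-oriented near-Kerr thick collar with cut energy and gap), every
`(ε₁, k₁)`-Kerr box of the collar's background inside `J⁺(C)` with `ε₁ ≤ ε⋆` is time-oriented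
(`BoxTimeOriented`).  WHY PLAUSIBLE / WHY A SEPARATE INPUT.  The box `{M < r < R + 1}` reaches the
near-horizon region, where the ingoing Kerr-star form and its time-reverse differ at order zero by
`≍ 1`, so for small `ε₁` a reversed presentation of a future black-hole region is excluded and (the box
being connected and `dΨ(ΛV)` timelike) the orientation is decided at one near-horizon point; a
genuinely reversed near-Kerr box is a white-hole-like region, which cannot meet `J⁺(C)` when
`C ⊆ J⁺(𝓘⁻)` — but no such argument is available in the tree, and exotic admissible data are not
excluded by the typed hypotheses.  The intended producer of the box (K2′ by spacelike marching from the
future-oriented collar, then `ExactMinimiserKerrnessOriented` and K3) HAS the orientation and merely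
drops it from its conclusion; threading a `BoxTimeOriented` clause through those conclusions and K4's
hypothesis discharges this input for free (recommended reshape).  Route-posited statement; nothing is
asserted. [conjecture] [folklore] -/
def RestCollarBoxOriented : Prop :=
  ∀ (χ m₀ : ℝ) (k₁ : ℕ), χ < 1 → 0 < m₀ → ∃ ε₀ : ℝ≥0∞, 0 < ε₀ ∧
    ∀ (ε₁ : ℝ≥0∞) (R T : ℝ) (k' : ℕ) (Λ δ : ℝ≥0∞) (γ : ℝ), ε₁ ≤ ε₀ → Λ < 1 →
    ∀ (X : Type) [TopologicalSpace X] [ChartedSpace E3 X] [IsManifold (𝓡 3) ∞ X]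
      [T2Space X] [SecondCountableTopology X] [ConnectedSpace X],
    ∀ D ∈ admissibleVacuumData X, ∀ (𝒟 : VacuumCauchyDevelopment D)
      (M a : Fin 1 → ℝ) (S : Set 𝒟.carrier) (p : 𝒟.carrier) (mo : Fin 1 → lorentzGroup × E4)
      (B : Fin 1 → ModelBackground) (Φ : ∀ i, (B i).domain → 𝒟.carrier),
    𝒟.IsMaximal → (∀ i, m₀ ≤ M i ∧ M i ≤ m₀⁻¹ ∧ |a i| ≤ χ * M i) →
    IsPinnedSoundNearKerrLeaf 𝒟.toCauchyDevelopment k' Λ 1 M a S → p ∈ S →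
    (∃ i, p ∈ Φ i '' (B i).truncTimeSlab (3 * M i) 0) → (mo 0).1 = 1 →
    𝒟.NearKerrCollarCore k' δ γ 1 M a S p mo B Φ →
    K2Route.CollarFutureOriented 𝒟 M mo B Φ → K2Route.CollarTimeOriented 𝒟 M a mo B Φ →
    ∀ (τ : ℝ) (Ψ : (B 0).domain → 𝒟.carrier),
      IsNearModelBox 𝒟.toSpacetime (B 0) k₁ ε₁ τ (τ + T) (M 0) (R + 1)
        (𝒟.metric.causalFuture 𝒟.timeOrientation (collarCore M p B Φ)) Ψ →
      BoxTimeOriented 𝒟 (M 0) (a 0) (mo 0) (B 0) τ (τ + T) (M 0) (R + 1) Ψ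

/-! ### Registered bookkeeping sub-goal (the anchor of this vocabulary file) -/

/-- **Registered bookkeeping sub-goal of the line** (`stub_discInNearZoneLayer`, brick for
`stub_farCompletion`): the hole disc `{t = 0, r ≤ R₁}` of a background lies in its truncated
near-zone layer `{−1 < t < 1, r < R₁ + 1} ∩ {r ≤ R₁}` — the inclusion through which the LAYER
certification (S₂) of the recentred box chart yields the slab certification (13) of the sound leaf K4
assembles (DHRT arXiv:2104.08222, §1: near-zone slabs inside layers).
[cite: DafermosHolzegelRodnianskiTaylor2021, §1] -/
theorem stub_discInNearZoneLayer : ∀ (B : ModelBackground) (R₁ : ℝ), B.truncTimeSlab R₁ 0 ⊆ {x | x ∈ nearLayer B R₁ ∧ B.radius x.1 ≤ R₁} := by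
  intro B R₁ x hx
  rw [ModelBackground.mem_truncTimeSlab] at hx
  exact ⟨⟨by rw [hx.1]; norm_num, by rw [hx.1]; norm_num, by linarith [hx.2]⟩, hx.2⟩

end Summit.FinalStateConjecture.FinalStateConjecture.Theorems.BondiBartnikRigidity.DirectMethod

end
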